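import Summits.BirchSwinnertonDyer.BirchSwinnertonDyer.Theorems.SmallImageMuTransferMuTransferOfFine
import Summits.BirchSwinnertonDyer.BirchSwinnertonDyer.Theorems.SmallImageMuTransferMuTransferOfZetaSide
import Summits.BirchSwinnertonDyer.BirchSwinnertonDyer.Theorems.SmallImageMuTransferMuTransferOfZetaSideAnyImage
import Summits.BirchSwinnertonDyer.BirchSwinnertonDyer.Theorems.SmallImageMuTransferMuTransferOfFineZetaContra
import Summits.BirchSwinnertonDyer.BirchSwinnertonDyer.Theorems.SmallImageMuTransferMuTransferOfZetaSideContra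
import Literature.NumberTheory.EllipticCurves.Kato2004.DivisibilityInputsZetaLine
import Literature.NumberTheory.EllipticCurves.Kato2004.DivisibilityInputsContragredient
import Literature.NumberTheory.EllipticCurves.Kato2004.ZetaSideInputsContragredient
import Literature.NumberTheory.EllipticCurves.Kato2004.ZetaSideInputsContragredientTransport
import HarnessLib

/-!
# Skeleton of record (BC3 shape) for the crux `MuTransfer` (stmt-BirchSwinnertonDyer-19629) — line
`f1-fine`: ONE stub = the published construction fact, RE-KEYED 2026-08-28 (gen 4) to its TRUE-SIZE, PRINT-EXACT
contragredient zeta side ZSᶜ; composition BY NAME through `Theorems.smallImageMuTransfer_MuTransfer_of_zetaSideContra`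

RESHAPE OF RECORD (seat `bsd-line-k6-p2` gen 4, 2026-08-28; lead protocol L4 «stub-misstated ⇒ reshape»).  Cell
`bsd-cited`'s ARM-P audit (r02 ADDENDUM-8, RULING (650), R-48, flag `Kato-1713-dual-action`) classified the γ-keyed
§17.13 packages F1 / F1′ / ZS — which bind Kato's (17.13.1) maps `P → X(E/ℚ_∞) → X₀(E/ℚ_∞)` as `Λ`-LINEAR maps into
the tree's duals `W.SelmerDualData κ γ` / `W.FineSelmerDualData κ γ` (`T` by PRE-composition with `conj_γ`) against
the covariant `IwasawaH1Data W p κ γ` — STRONGER-THAN-PRINT-BY-ι: local Tate duality is `Γ`-invariant, so the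
printed `Λ`-linear (17.13.1) lands in the CONTRAGREDIENT duals `W.SelmerDualData κ γ⁻¹` / `W.FineSelmerDualData κ γ⁻¹`.
The print-exact twins are F1ᶜ = `Kato2004.exists_divisibilityInputs_fineQuotient_zeta_contra` (VERBATIM F1 with that one
change; cell bsd-stepL guest typer, p604443) and, at the TRUE SIZE of what the μ-road consumes (no `𝐇²`, no Euler-system
divisibility theorem — gen 2's reading), ZSᶜ = `Kato2004.exists_zetaSideInputs_contra` (VERBATIM ZS with that one change;
this seat gen 4, p616215; F1ᶜ ⟹ ZSᶜ by `Kato2004.exists_zetaSideInputs_contra_of_fineQuotient_zeta_contra`).  The single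
stub is therefore re-keyed `stub_inputs : F1` ↦ `stub_zetaSide_contra : ZSᶜ`, and the composition runs through the μ-road
re-key `Theorems.smallImageMuTransfer_MuTransfer_of_zetaSideContra : ZSᶜ → MuTransfer` (this seat gen 4: twists
T-TWIST-SEL-1 of `D` and of a fine dual `Y`, the γ-keyed image-facts core, the ι-fixed prime `(p)`; μ is ι-invariant, no
functional equation).  The F1ᶜ door `Theorems.smallImageMuTransfer_MuTransfer_of_fineZetaContra` (p615445) is recorded as
`MuTransfer_of_fineZetaContra`; every γ-keyed door below is KEPT as a sorry-free record (F1, F1′, ZS each still imply the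
crux in the kernel; what changed is which input print supplies as stated).  The aside item stmt-BirchSwinnertonDyer-19843
names F1; re-pointing it to ZSᶜ (or F1ᶜ) is the planner's call.

TRANSPORT CLOSURE (seat `bsd-line-k6-p2` gen 5, 2026-08-28; stub list UNCHANGED).  ZSᶜ quantifies over ALL pinned
triples `(I, D, Y)`; a port of Kato's construction builds ONE.  The gap is now closed in the kernel:
`Kato2004.exists_zetaSideInputs_contra_of_model` (Literature file `Kato2004/ZetaSideInputsContragredientTransport.lean`:
the package moves along the uniqueness isomorphisms of `𝐇¹_Γ(T_pW)` — projection-compatible, `IwasawaH1Data.exists_linearEquiv`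
— and of the two Pontryagin duals at ANY key, `SelmerDualData.exists_linearEquiv` / `FineSelmerDualData.exists_linearEquiv`,
the latter from the new Literature file `KatoFineSelmerDualUniquenessProofs.lean`, p620116).  Door `MuTransfer_of_model` below
(sorry-free, not a stub; its hypothesis is the ONE-MODEL form of ZSᶜ spelled inline — no new named fact).

HISTORY (before gen 4):

Cell `bsd-smallim` (rung K6 of `BirchSwinnertonDyer`, class X9), seat `bsd-line-k6-p2` (D-0154 KEY (146)
row 9, 2026-08-28).  The item is wanted by `route-BirchSwinnertonDyer-SmallImageMuTransfer` (rank 2; decl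
`Theses.SmallImageMuTransfer.MuTransfer := Rank1Residual.KatoMuTransfer`) and by
`route-BirchSwinnertonDyer-PrintX9` (rank 4; `Theses.PrintX9.MuTransfer`, the same constant).

This file is the TREE COPY of the registered skeleton v3 (planner bsd-smallim-plan g12, 2026-08-27T01:39:59Z,
sha bd1a221c…; the planner's file lives in its session folder and was attached as item evidence
`MuTransfer_birth_v3.lean`; the Cruxes/MuTransfer directory had no workfile).  It asserts NO new
mathematics: it records, in skeleton form, that the parent crux is KERNEL-CHECKED MODULO THE PUBLISHED
INPUT F1 ALONE —

* `stub_inputs : F1`, F1 = `Literature.NumberTheory.EllipticCurves.Kato2004.exists_divisibilityInputs_fineQuotient_zeta`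
  (Kato 2004, Astérisque 295: Thm. 12.4 (1), 12.5 (2)–(4), 12.6 with Ex. 13.3, Thm. 16.6 (2), Prop. 17.11,
  §17.13 (17.13.1)–(17.13.4) and p. 280, with the fine quotient (14.9.3)/(17.13.1): ONE construction fact on
  the pinned pair `(𝐇¹_Γ(T_pW), X(E/ℚ_∞))`; aside item stmt-BirchSwinnertonDyer-19843; no `_holds`; size XL;
  director-bsd 2026-08-27T01:07:55Z: «K6 rests here», the port is not a K6 item).  The ONLY open obligation.
* `MuTransfer_of` — the composition, sorry-free: `Theorems.smallImageMuTransfer_MuTransfer_of_fine` (k6-c2 g6,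
  p482919): surjective branch = Kato Thm. 17.4 derived from F1's `integral` field + `charIdeal_isPrincipal_holds`;
  non-surjective branch (CM included) = the typed core of the cell's Theorem A, `X10.mu_eq_zero_of_fine`
  (`X10.coreTheoremAOddPrime_holds`, p480380).
* `MuTransfer_of_zetaLine` — the SAME door re-keyed to the print-verbatim restatement
  F1′ = `Kato2004.exists_divisibilityInputsZetaLine_fineQuotient_zeta` (bsd-print-x9 ty1, p539168; F1′ ⟹ F1 by
  `exists_divisibilityInputs_fineQuotient_zeta_of_zetaLine`), sorry-free, NOT a stub: recorded because the
  director's W-61 P.S. «modulo F1′ CONFIRMED» (refuter bsd-f3-mu ref2 g16, evidence `placement-g16.md` on this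
  item) names F1′ as the alternative key of the single stub.
* `MuTransfer_of_zetaSide_of_kato` — the door found by this seat (2026-08-28, p606929 + the Theorems file
  `SmallImageMuTransferMuTransferOfZetaSide`): the crux from the ZETA SIDE of Kato's package
  (ZS = `Kato2004.exists_zetaSideInputs`: (17.13.1) at `P`, Prop. 17.11 injectivity, Thm. 12.6 + Ex. 13.3,
  Thm. 16.6 (2) + 17.5 read at `(p)`, (14.9.3)) AND Kato's Thm. 17.4 by name (`kato_divisibility`), sorry-free,
  NOT a stub; F1 ⟹ ZS ∧ Thm. 17.4, so re-keying `stub_inputs` as these two inputs loses nothing and drops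
  Kato's Euler-system divisibility theorems (12.4, 12.5 (2)–(4), 13.4) from the non-surjective branch —
  the planner's call.
* `MuTransfer_of_zetaSide` — the door found by this seat's gen 2 (2026-08-28, p610284, Theorems file
  `SmallImageMuTransferMuTransferOfZetaSideAnyImage`): the crux from the ZETA SIDE ALONE,
  `Theorems.smallImageMuTransfer_MuTransfer_of_zetaSide : ZS → MuTransfer`, sorry-free, NOT a stub.  The
  surjective branch runs through the kernel `μ`-core too (cell `bsd-potss`' image-facts form
  `CoreAssembly.coreIrr_anyReduction_holds` + `GL₂(𝔽_p)`, `p` odd, has no normal subgroup of index `p`), so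
  Kato's Thm. 17.4 and every Euler-system DIVISIBILITY theorem (12.4, 12.5 (2)–(4), 13.4, (17.13.2)/(17.13.4))
  are out of the cone of the WHOLE crux.  Since 2026-08-28 gen 2 the composition `MuTransfer_of` goes through
  THIS door (F1 ⟹ ZS ⟹ crux); p482919's composition is kept as `MuTransfer_of_fine_record`.  Re-keying the
  single stub as `stub_zetaSide : Kato2004.exists_zetaSideInputs` loses nothing — the planner's call.
* `MuTransfer_of_stubs` — the ONLY theorem concluding the crux decl by name (HarnessLib skeleton audit).

Nothing here proves a case of BSD; the item stays OPEN by design until F1ᶜ (or F1′ᶜ, or a print-exact zeta-side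
sub-package of it) has a `_holds`.
-/

set_option linter.dupNamespace false

namespace Summit.BirchSwinnertonDyer.BirchSwinnertonDyer.Cruxes.MuTransfer.F1Fine

open scoped MatrixGroups ModularForm
open Literature.NumberTheory.EllipticCurves.Kato2004
open Summit.BirchSwinnertonDyer.BirchSwinnertonDyer.Theses.SmallImageMuTransfer

/-- stub 1 (the only one) = the published construction fact at its TRUE SIZE and in its PRINT-EXACT contragredient
form ZSᶜ: Kato 2004's zeta-side package at `(p)` on `(𝐇¹_Γ(T_pW), X(E/ℚ_∞), X₀(E/ℚ_∞))` — the zeta-element construction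
with Thm. 12.5 (1), Thm. 12.6 + Ex. 13.3 span, Thm. 16.6 (2) + 17.5 read at `(p)`, Prop. 17.11 injectivity, (17.13.1) exact at
`P`, the fine quotient (14.9.3) — duals `W.SelmerDualData κ γ⁻¹` / `W.FineSelmerDualData κ γ⁻¹` (file
`Kato2004/ZetaSideInputsContragredient`, p616215; flag `Kato-1713-dual-action`).  OPEN: no `_holds` in the tree; discharging
it is the port of Kato's CONSTRUCTION (XL; no Euler-system divisibility theorem 12.4 / 12.5 (2)–(4) / 13.4 / 17.4 needed).
Re-keyed from `stub_inputs : F1` (γ-keyed, ι-stronger than print) by the lead, gen 4, 2026-08-28. -/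
theorem stub_zetaSide_contra : exists_zetaSideInputs_contra := by
  sorry

/-- Local alias of the crux constant, so that exactly ONE theorem below (`MuTransfer_of_stubs`)
concludes the crux decl by name. -/
def CruxGoal : Prop :=
  Summit.BirchSwinnertonDyer.BirchSwinnertonDyer.Theses.SmallImageMuTransfer.MuTransfer

/-- The door through the zeta side ALONE (sorry-free; not a stub): ZS ⟹ crux,
`Theorems.smallImageMuTransfer_MuTransfer_of_zetaSide` (gen 2, p610284).  No Kato Thm. 17.4. -/
theorem MuTransfer_of_zetaSide (h : exists_zetaSideInputs) : CruxGoal :=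
  Summit.BirchSwinnertonDyer.BirchSwinnertonDyer.Theorems.smallImageMuTransfer_MuTransfer_of_zetaSide h

/-- Composition (sorry-free): the parent crux from the TRUE-SIZE PRINT-EXACT zeta side ZSᶜ alone —
`Theorems.smallImageMuTransfer_MuTransfer_of_zetaSideContra` (this seat gen 4): twist the γ-keyed `D` and a fine dual
`Y` to the contragredient structure, apply ZSᶜ to `(𝐇¹_γ, D′, Y′)`, run the μ-road (GV Prop. 3.7, the `(p)`-clause,
Thm. 12.6 span, the image-facts core, `Sel₀[p]` finite ⟹ `length_(p) Y′.X = 0 ⟹ length_(p) D′.X = 0`), and return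
through the ι-fixed prime `(p)`.  Since gen 4 (2026-08-28) this is the composition of the line. -/
theorem MuTransfer_of (h : exists_zetaSideInputs_contra) : CruxGoal :=
  Summit.BirchSwinnertonDyer.BirchSwinnertonDyer.Theorems.smallImageMuTransfer_MuTransfer_of_zetaSideContra h

section OneModel

open Literature.NumberTheory.EllipticCurves Literature.NumberTheory.EllipticCurves.ModularForms

/-- The ONE-MODEL door (sorry-free; not a stub; gen 5): if for every admissible `(W, p, f, κ, γ)` — exactly the outer
binders of ZSᶜ — Kato's contragredient zeta-side package exists for SOME pinned triple `(I, D, Y)` (what a port of the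
construction actually builds: its own `𝐇¹`, `X`, `X₀`), then the crux: the transport closure
`Kato2004.exists_zetaSideInputs_contra_of_model` (uniqueness of the three pins up to `Λ`-isomorphism; Literature file
`Kato2004/ZetaSideInputsContragredientTransport.lean`) followed by `MuTransfer_of`.  The hypothesis is the one-model form
of the registered stub, spelled inline (no new named fact; ZSᶜ ⟹ it trivially, it ⟹ ZSᶜ by that theorem). -/
theorem MuTransfer_of_model
    (h : ∀ (W : WeierstrassCurve ℚ) [W.IsElliptic] [W.IsGloballyMinimal] (p : ℕ) [Fact p.Prime]
      [ContinuousSMul ℤ_[p] (W.tateModule p)] [Module.Free ℤ_[p] (W.tateModule p)]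
      [Module.Finite ℤ_[p] (W.tateModule p)] {N : ℕ} [NeZero N] (f : CuspForm (CongruenceSubgroup.Gamma0 N) 2)
      (κ : ZpExtension ℚ p) (γ : Field.absoluteGaloisGroup ℚ),
      p ≠ 2 → IsOrdinaryAt W p → κ.IsCyclotomic → κ.IsTopGenerator γ → IsCyclotomicVariable p γ →
      IsNewformOf W f →
      ∃ (I : IwasawaH1Data W p κ γ) (D : W.SelmerDualData κ γ⁻¹) (Y : W.FineSelmerDualData κ γ⁻¹),
        Nonempty (ZetaSideInputsContra W p f κ γ I D Y)) : CruxGoal :=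
  MuTransfer_of (exists_zetaSideInputs_contra_of_model h)

end OneModel

/-- The door through the print-exact FULL §17.13 package F1ᶜ = `Kato2004.exists_divisibilityInputs_fineQuotient_zeta_contra`
(sorry-free; not a stub): F1ᶜ ⟹ ZSᶜ (`Kato2004.exists_zetaSideInputs_contra_of_fineQuotient_zeta_contra`, forgetting 19 fields)
⟹ crux.  Directly: `Theorems.smallImageMuTransfer_MuTransfer_of_fineZetaContra` (this seat gen 4, p615445). -/
theorem MuTransfer_of_fineZetaContra (h : exists_divisibilityInputs_fineQuotient_zeta_contra) : CruxGoal :=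
  MuTransfer_of (exists_zetaSideInputs_contra_of_fineQuotient_zeta_contra h)

/-- The same door keyed to the print-exact twin WITH THE ZETA LINE, F1′ᶜ =
`Kato2004.exists_divisibilityInputsZetaLine_fineQuotient_zeta_contra` (sorry-free; not a stub): F1′ᶜ ⟹ F1ᶜ
(`exists_divisibilityInputs_fineQuotient_zeta_contra_of_zetaLine`) ⟹ ZSᶜ ⟹ crux. -/
theorem MuTransfer_of_zetaLineContra (h : exists_divisibilityInputsZetaLine_fineQuotient_zeta_contra) : CruxGoal :=
  MuTransfer_of_fineZetaContra (exists_divisibilityInputs_fineQuotient_zeta_contra_of_zetaLine h)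

/-- RECORD (γ-keyed, before gen 4; sorry-free, NOT a stub): the parent crux from F1 alone THROUGH THE ZETA SIDE —
F1 ⟹ ZS (`Kato2004.exists_zetaSideInputs_of_fineQuotient_zeta`) ⟹ crux (`MuTransfer_of_zetaSide`); the composition
of the line from gen 2 to gen 4.  F1 is ι-stronger than print as a package (ARM-P R-48). -/
theorem MuTransfer_of_fine_viaZetaSide_record (h : exists_divisibilityInputs_fineQuotient_zeta) : CruxGoal :=
  MuTransfer_of_zetaSide (exists_zetaSideInputs_of_fineQuotient_zeta h)

/-- The composition of record before gen 2 (sorry-free): the parent crux from F1 alone, k6-c2 g6 (p482919;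
surjective branch = Kato Thm. 17.4 read off F1's `integral` field). Kept for comparison. -/
theorem MuTransfer_of_fine_record (h : exists_divisibilityInputs_fineQuotient_zeta) : CruxGoal :=
  Summit.BirchSwinnertonDyer.BirchSwinnertonDyer.Theorems.smallImageMuTransfer_MuTransfer_of_fine h

/-- RECORD (γ-keyed; sorry-free, not a stub): the door keyed to the restatement F1′ — F1′ ⟹ F1 ⟹ crux. -/
theorem MuTransfer_of_zetaLine (h : exists_divisibilityInputsZetaLine_fineQuotient_zeta) : CruxGoal :=
  MuTransfer_of_fine_viaZetaSide_record (exists_divisibilityInputs_fineQuotient_zeta_of_zetaLine h)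

/-- The door through the zeta side (sorry-free; not a stub): ZS ∧ (Kato Thm. 17.4 at every datum) ⟹ crux,
`Theorems.smallImageMuTransfer_MuTransfer_of_zetaSide_of_kato`.  Both hypotheses are implied by F1. -/
theorem MuTransfer_of_zetaSide_of_kato (h₁ : exists_zetaSideInputs)
    (h₂ : ∀ (W : WeierstrassCurve ℚ) [W.IsElliptic] [W.IsGloballyMinimal] (p : ℕ) [Fact p.Prime]
      (κ : Literature.NumberTheory.EllipticCurves.ZpExtension ℚ p) (γ : Field.absoluteGaloisGroup ℚ)
      (N : ℕ) [NeZero N] (f : CuspForm (CongruenceSubgroup.Gamma0 N) 2),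
      Literature.NumberTheory.EllipticCurves.kato_divisibility W p (κ := κ) (γ := γ) (f := f)) : CruxGoal :=
  Summit.BirchSwinnertonDyer.BirchSwinnertonDyer.Theorems.smallImageMuTransfer_MuTransfer_of_zetaSide_of_kato
    h₁ h₂

/-- Comparison with the record (sorry-free): F1 ALONE still opens the zeta-side door — F1 ⟹ ZS
(`Kato2004.exists_zetaSideInputs_of_fineQuotient_zeta`) and F1 ⟹ Kato Thm. 17.4 at every datum (k6-c2 g6,
`Theorems.smallImageMuTransfer_kato_divisibility_of_fine`, p482919).  So the hypothesis of
`MuTransfer_of_zetaSide_of_kato` is WEAKER than that of `MuTransfer_of`. -/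
theorem MuTransfer_of_fine_via_zetaSide (h : exists_divisibilityInputs_fineQuotient_zeta) : CruxGoal :=
  MuTransfer_of_zetaSide_of_kato (exists_zetaSideInputs_of_fineQuotient_zeta h)
    fun W _ _ p _ κ γ _ _ f ↦
      Summit.BirchSwinnertonDyer.BirchSwinnertonDyer.Theorems.smallImageMuTransfer_kato_divisibility_of_fine
        h W p (κ := κ) (γ := γ) (f := f)

/-- The crux BY NAME from the single registered stub (the only theorem concluding the crux decl). -/
theorem MuTransfer_of_stubs :
    Summit.BirchSwinnertonDyer.BirchSwinnertonDyer.Theses.SmallImageMuTransfer.MuTransfer :=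
  MuTransfer_of stub_zetaSide_contra

/-- Sanity: the route decl is the tree's `Rank1Residual.KatoMuTransfer` (and so is `Theses.PrintX9.MuTransfer`,
dedup by signature). -/
example :
    Summit.BirchSwinnertonDyer.BirchSwinnertonDyer.Theses.SmallImageMuTransfer.MuTransfer =
      Summit.BirchSwinnertonDyer.BirchSwinnertonDyer.Rank1Residual.KatoMuTransfer :=
  rfl

end Summit.BirchSwinnertonDyer.BirchSwinnertonDyer.Cruxes.MuTransfer.F1Fine
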